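import Literature.Geometry.Lorentzian.KerrSeparatedPotential
import Literature.Geometry.Lorentzian.KerrCombinedCurrent
import Literature.Geometry.Lorentzian.KerrTortoiseRadius
import Literature.Geometry.Lorentzian.KerrStarWaveOperator
import Mathlib.Analysis.InnerProductSpace.l2Space
import Mathlib.MeasureTheory.Function.L2Space

/-!
# Stub `stub_integratedDecayOfKernel` (S6 of line `olver-dunster-uniform-reduction`): BLOCKED —
# the Carter-separation layer (DRSR arXiv:1402.7034 §5) does not exist in the tree

This is a SCRATCH/record file (nothing here is landed). S6 is the implication
`(S4: cone Wronskian lower bound) → (S5: cone Green-kernel bound) → clause (b)` of the crux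
`PhaseMixingCapture.KappaExplicitWaveDecay`. Hypotheses S4/S5 speak about solutions of Carter's
separated radial ODE (`Kerr.IsRadialTeukolskySolution`, `Kerr.radialWronskian`); the conclusion speaks
about solutions `ψ` of `□_g ψ = 0` on `Kerr.exterior M a` (`localSliceEnergy`). Any proof must pass
through Carter's separation with Plancherel (DRSR §5.2, Prop. 5.2.1, Lemmas 5.3.1/5.3.2/5.4.1), which the
tree does not have: `KerrSeparatedProfile` separates axisymmetric (`m = 0`) PROFILES forward,
`KerrCarterCommutation` proves `[𝓡, 𝓐] = 0` on axisymmetric functions, `KerrStarWaveOperator` gives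
`ρ²□_g` in `(t*, r, θ, φ*)` (`Kerr.blSigma_mul_coordWave_starChart`), the barrier file
`KleinGordonSuperradiantInstabilityInputs` gives the reduced operator on ONE separated mode
(`reducedWaveOp_kerrStar`), and `Literature/Analysis/SpecialFunctions/SpheroidalHarmonic*` construct
`m`-spheroidal eigenfunction BRANCHES for spheroidicity `κ_sph = a²(ω² − μ²) ≤ 0` only
(`exists_eigenvalue_branch`; the wave equation needs `κ_sph = a²ω² ≥ 0`) with NO completeness. There
is no `t*`-Fourier/Plancherel statement for functions on the Kerr chart (Mathlib has
`MeasureTheory.Lp.fourierTransformₗᵢ`; the tree has Parseval on compact abelian groups,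
`Literature.Analysis.Fourier.hasSum_norm_sq_integral_conj_addChar_mul`).

Below: the FIRST missing theorem (M1, DRSR §5.2.1) as an elaborating `Prop`, and the consumer-level
separation statement (M2, DRSR Prop. 5.2.1 + §5.2.2 Plancherel displays + §5.3) as an elaborating
`Prop` over tree vocabulary (`Kerr.kerrStar`, `E4.ofTimeSpace`, `Kerr.IsTortoiseRadius`,
`Kerr.sepPotential`, `Kerr.IsAdmissibleTriple`, `Kerr.OutgoingBoundary`, `Kerr.horizonAngularVelocity`),
for the planner to size a separation crux. Neither is proved here.
-/

set_option linter.dupNamespace false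

noncomputable section

namespace Summit.FinalStateConjecture.FinalStateConjecture.Theorems.KappaExplicitWaveDecay.OlverDunsterUniformReduction.S6Missing

open Literature.Geometry.Lorentzian
open MeasureTheory Filter Set Complex
open scoped Topology ENNReal Real

/-- **M1 (first missing theorem; DRSR arXiv:1402.7034 §5.2.1).** For every azimuthal number `m` and
real spheroidicity `ν` (`= aω`), the oblate spheroidal functions `S_{mℓ}(ν, x)`, `x = cos θ`, form a
Hilbert basis of `L²((−1,1), dx)` consisting of smooth bounded eigenfunctions of
`(1 − x²)S″ − 2xS′ + (Λ − ν²(1 − x²) − m²/(1 − x²))S = 0` (`Λ = λ_{mℓ}(ν) + ν²`), and the eigenvalues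
satisfy DRSR's two inequalities `Λ ≥ |m|(|m|+1)`, `Λ ≥ 2|mν|` — i.e. `(ω, m, Λ_{mℓ}(aω) + a²ω²)` is an
admissible triple (`Kerr.IsAdmissibleTriple a ω m Λ`). Not in tree; nearest:
`Literature.Analysis.SpecialFunctions.sphmEig` / `exists_eigenvalue_branch` (even branches, `κ_sph ≤ 0`),
`Literature.Analysis.Calculus.HomL2.eigenfamily` (`ν = 0`, finite shells),
`Literature.Analysis.Fourier.exists_hilbertBasis_addCharLp` (Fourier series in `φ`). -/
def OblateSpheroidalBasis : Prop :=
  ∀ (m : ℤ) (ν : ℝ),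
    ∃ (Λ : ℕ → ℝ) (S : ℕ → ℝ → ℝ)
      (b : HilbertBasis ℕ ℝ (Lp ℝ 2 (volume.restrict (Ioo (-1 : ℝ) 1)))),
      (∀ ℓ, ((b ℓ : Lp ℝ 2 (volume.restrict (Ioo (-1 : ℝ) 1))) : ℝ → ℝ) =ᵐ[volume.restrict (Ioo (-1 : ℝ) 1)]
        S ℓ) ∧
      (∀ ℓ, ContDiffOn ℝ ((⊤ : ℕ∞) : WithTop ℕ∞) (S ℓ) (Ioo (-1 : ℝ) 1)) ∧
      (∀ ℓ, ∃ C : ℝ, ∀ x ∈ Ioo (-1 : ℝ) 1, |S ℓ x| ≤ C ∧ (1 - x ^ 2) * |deriv (S ℓ) x| ≤ C) ∧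
      (∀ ℓ, ∀ x ∈ Ioo (-1 : ℝ) 1,
        (1 - x ^ 2) * deriv (deriv (S ℓ)) x - 2 * x * deriv (S ℓ) x +
          (Λ ℓ - ν ^ 2 * (1 - x ^ 2) - (m : ℝ) ^ 2 / (1 - x ^ 2)) * S ℓ x = 0) ∧
      (∀ ℓ, |(m : ℝ)| * (|(m : ℝ)| + 1) ≤ Λ ℓ ∧ 2 * |(m : ℝ) * ν| ≤ Λ ℓ)

/-- Pull-back of a chart function to Kerr's ingoing spheroidal coordinates `(t*, r, θ, φ*)`:
`G(t, r, θ, φ) = Ψ(t, Y_a(r, θ, φ))` (`Kerr.kerrStar`, `E4.ofTimeSpace`). -/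
def starPull4 (a : ℝ) (Ψ : E4 → ℝ) (t r θ φ : ℝ) : ℝ :=
  Ψ (E4.ofTimeSpace t (Kerr.kerrStar a r θ φ))

/-- The `t*`-Fourier transform at fixed `(r, θ, φ*)`, DRSR normalisation
`Ψ = (2π)^{-1/2}∫ e^{−iωt} Ψ̂ dω` (explicit integral: meaningful for `Ψ` integrable in `t*`). -/
def timeFourier (a : ℝ) (Ψ : E4 → ℝ) (ω r θ φ : ℝ) : ℂ :=
  (1 / Real.sqrt (2 * π) : ℝ) * ∫ t : ℝ, exp (I * (ω * t : ℝ)) * (starPull4 a Ψ t r θ φ : ℂ)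

/-- The oblate-spheroidal coefficient `Ψ^{KS}_{mℓ}(ω, r)` of `Ψ̂(ω, r, ·, ·)` against
`S_{mℓ}(aω, cos θ) e^{imφ}/√(2π)` for the measure `sin θ dθ dφ` (Kerr–Schild/Kerr-star phases). -/
def sphCoeff (a : ℝ) (S : ℝ → ℤ → ℕ → ℝ → ℝ) (Ψ : E4 → ℝ) (ω : ℝ) (m : ℤ) (ℓ : ℕ) (r : ℝ) : ℂ :=
  ∫ θ in (0 : ℝ)..π, ∫ φ in (0 : ℝ)..(2 * π),
    timeFourier a Ψ ω r θ φ * (S (a * ω) m ℓ (Real.cos θ) : ℂ) *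
      exp (-(I * ((m : ℝ) * φ : ℝ))) * ((1 / Real.sqrt (2 * π) * Real.sin θ : ℝ) : ℂ)

/-- **M2 (consumer-level missing theorem; DRSR Prop. 5.2.1, §5.2.2 (Plancherel displays), Lemmas
5.3.1–5.3.2, 5.4.1), stated over tree vocabulary for `Ψ` smooth on the chart, compactly supported in
`t*` on bounded-`r` regions and vanishing for large `r` together with `F = □_gΨ` given in coordinates
(the `L²`-in-`t*` class of DRSR Def. 5.1.1 needs Mathlib's `Lp.fourierTransformₗᵢ` instead of
`timeFourier`).** With the basis `S` of M1 and a tortoise radius `R`: the Boyer–Lindquist-phased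
coefficient `u(x) = √(R² + a²) e^{iϑ(R)} Ψ^{KS}_{mℓ}(ω, R(x))`, `dϑ/dr = (am − 2Mωr)/Δ`, is for a.e.
`ω` and all `m, ℓ` a `C²` solution of `u″ + (ω² − V_{(ω,m,Λ)}(R))u = H` (`V = Kerr.sepPotential`,
`Λ = Λ_{mℓ}(aω)` admissible) with DRSR's outgoing boundary behaviour (`Kerr.OutgoingBoundary`), and the
Parseval identities hold at each `r > r₊` (here: the `|Ψ|²`, `|∂_{t*}Ψ|²` and `Λ`-weighted ones;
`∑Λ|Ψ_{mℓ}|² = ∫(|∂_θΨ|² + |∂_φΨ|²/sin²θ + a² sin²θ |∂_tΨ|²)`, from `⟨(P(ν) + ν²)f, f⟩ =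
∫|∇̸f|² + ν²∫sin²θ|f|²`, `P(ν) = −Δ̸ − ν²cos²θ`; the sign of the `a²cos²θ|∂_tΨ|²` term in the
arXiv display of §5.2.2 is a misprint). Also needed downstream and omitted here: the `|∂_rΨ|²`
identity (Boyer–Lindquist `∂_r = ∂_r|_* + (2Mr/Δ)∂_{t*} + (a/Δ)∂_{φ*}`) and the `H`/source pairings. -/
def CarterSeparationParseval (M a : ℝ) : Prop :=
  ∀ (S : ℝ → ℤ → ℕ → ℝ → ℝ) (Λ : ℝ → ℤ → ℕ → ℝ) (R : ℝ → ℝ) (Ψ F : E4 → ℝ) (T ρ r₀ : ℝ),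
    Kerr.IsTortoiseRadius M a R → r₀ < Kerr.rPlus M a →
    -- `S ν m ℓ`, `Λ ν m ℓ`: an oblate spheroidal basis as in `OblateSpheroidalBasis` (abbreviated here
    -- to the eigen-equation and admissibility; the Hilbert-basis clause is M1)
    (∀ ν m ℓ, ∀ x ∈ Ioo (-1 : ℝ) 1,
        (1 - x ^ 2) * deriv (deriv (S ν m ℓ)) x - 2 * x * deriv (S ν m ℓ) x +
          (Λ ν m ℓ - ν ^ 2 * (1 - x ^ 2) - (m : ℝ) ^ 2 / (1 - x ^ 2)) * S ν m ℓ x = 0) →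
    (∀ ω m ℓ, Kerr.IsAdmissibleTriple a ω m (Λ (a * ω) m ℓ)) →
    -- `Ψ` smooth on the HORIZON-PENETRATING chart `{r > r₀}`, `r₀ < r₊` (regularity across `𝓗⁺` is
    -- what gives (eq:b−), DRSR Lemma 5.3.1), supported in `{0 ≤ t* ≤ T, r ≤ ρ}`; `F = □_g Ψ` in
    -- divergence form (`Kerr.dalembertian_eq_divergence`)
    (∀ x ∈ (Kerr.region a r₀ : Set E4), ContDiffAt ℝ ((⊤ : ℕ∞) : WithTop ℕ∞) Ψ x) →
    (∀ x ∈ (Kerr.region a r₀ : Set E4), (x 0 < 0 ∨ T < x 0 ∨ ρ < Kerr.radius a x) → Ψ x = 0) →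
    (∀ x ∈ (Kerr.region a r₀ : Set E4),
        F x = ∑ μ, fderiv ℝ (fun y ↦ ∑ ν, Kerr.inverseMetric M a y μ ν * fderiv ℝ Ψ y (E4.basisVector ν)) x
          (E4.basisVector μ)) →
    ∃ (ϑ : ℝ → ℤ → ℝ → ℝ),
      (∀ ω m, ∀ r, Kerr.rPlus M a < r →
        HasDerivAt (ϑ ω m) ((a * m - 2 * M * ω * r) / Kerr.delta M a r) r) ∧
      -- (i) the radial ODE with outgoing boundary behaviour, for a.e. `ω` and all `m, ℓ`
      (∀ᵐ ω : ℝ, ∀ (m : ℤ) (ℓ : ℕ), ∃ (u₁ u₂ H : ℝ → ℂ) (Atop Abot : ℝ),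
        let u : ℝ → ℂ := fun x ↦ ((Real.sqrt (R x ^ 2 + a ^ 2) : ℝ) : ℂ) *
          exp (I * (ϑ ω m (R x) : ℝ)) * sphCoeff a S Ψ ω m ℓ (R x)
        (∀ x, H x = ((Kerr.delta M a (R x) / ((R x ^ 2 + a ^ 2) * Real.sqrt (R x ^ 2 + a ^ 2)) : ℝ) : ℂ) *
            exp (I * (ϑ ω m (R x) : ℝ)) *
            sphCoeff a S (fun y ↦ (Kerr.radius a y ^ 2 + a ^ 2 * Kerr.cosTheta a y ^ 2) * F y) ω m ℓ (R x)) ∧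
        (∀ x, HasDerivAt u (u₁ x) x) ∧ (∀ x, HasDerivAt u₁ (u₂ x) x) ∧
        (∀ x, u₂ x + ((ω ^ 2 - Kerr.sepPotential M a ω m (Λ (a * ω) m ℓ) (R x) : ℝ) : ℂ) * u x = H x) ∧
        Kerr.OutgoingBoundary ω (ω - Kerr.horizonAngularVelocity M a * m)
          (fun x ↦ Kerr.sepPotential M a ω m (Λ (a * ω) m ℓ) (R x)) u u₁ Atop Abot) ∧
      -- (ii) Parseval at each `r > r₊` (DRSR §5.2.2): `|Ψ|²`, `|∂_{t*}Ψ|²`, and the `Λ`-weighted identity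
      (∀ r, Kerr.rPlus M a < r →
        (∫ ω : ℝ, ∑' (p : ℤ × ℕ), ‖sphCoeff a S Ψ ω p.1 p.2 r‖ ^ 2) =
          ∫ t : ℝ, ∫ θ in (0 : ℝ)..π, ∫ φ in (0 : ℝ)..(2 * π),
            starPull4 a Ψ t r θ φ ^ 2 * Real.sin θ) ∧
      (∀ r, Kerr.rPlus M a < r →
        (∫ ω : ℝ, ∑' (p : ℤ × ℕ), ω ^ 2 * ‖sphCoeff a S Ψ ω p.1 p.2 r‖ ^ 2) =
          ∫ t : ℝ, ∫ θ in (0 : ℝ)..π, ∫ φ in (0 : ℝ)..(2 * π),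
            deriv (fun s ↦ starPull4 a Ψ s r θ φ) t ^ 2 * Real.sin θ) ∧
      (∀ r, Kerr.rPlus M a < r →
        (∫ ω : ℝ, ∑' (p : ℤ × ℕ), Λ (a * ω) p.1 p.2 * ‖sphCoeff a S Ψ ω p.1 p.2 r‖ ^ 2) =
          ∫ t : ℝ, ∫ θ in (0 : ℝ)..π, ∫ φ in (0 : ℝ)..(2 * π),
            (deriv (fun s ↦ starPull4 a Ψ t r s φ) θ ^ 2 +
              deriv (fun s ↦ starPull4 a Ψ t r θ s) φ ^ 2 / Real.sin θ ^ 2 +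
              a ^ 2 * Real.sin θ ^ 2 * deriv (fun s ↦ starPull4 a Ψ s r θ φ) t ^ 2) * Real.sin θ)

end Summit.FinalStateConjecture.FinalStateConjecture.Theorems.KappaExplicitWaveDecay.OlverDunsterUniformReduction.S6Missing

end
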